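import Summits.BirchSwinnertonDyer.BirchSwinnertonDyer.Theorems.AdditiveRankOneBSDpOfExactIndexManin
import Summits.BirchSwinnertonDyer.BirchSwinnertonDyer.Theorems.KatoDescentPotSupersingularWildUpperHeegnerTwist
import Summits.BirchSwinnertonDyer.Rank1Residual.WAll.TargetAdditiveAtThreeCells
import Literature.NumberTheory.EllipticCurves.ZywinaCMImageProofs
import Literature.NumberTheory.EllipticCurves.ComplexMultiplicationHasCMProofs
import HarnessLib

/-!
# The terminal step of the W-ALL kernel `ToricKernelAtThree` (stmt-BirchSwinnertonDyer-20390) ON THE WILD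
# CELL: exact Heegner index at slack `v₃(c)` + the rank-zero wild leaf `WAllExclAddWildRankZero` ⟹ `BSD₃(E)`

Seat `bsd-potss-kmc`, gen 17 (cell `bsd-potss`; service on bsd-wall-pss3's route `UniversalToricDescent`).
ROUTE-FREE (imports no `Theses.*`; `WAllExclAddWildRankZero` is the W-ALL slice leaf of
`Rank1Residual/WAll/TargetAdditiveAtThreeCells.lean`, which route UTD's crux `WildRankZeroTwistAtThree`
abbreviates BY NAME).

`bsdp_three_of_exactIndexManin_of_wAllExclAddWildRankZero`: for `E/ℚ` (globally minimal `W`) on the wild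
class `ClassO6 W 3` with `ρ̄_{E,3}` onto and `r_an = 1`, a Heegner datum `(N, K, Dt, H, ι, P)` with `d_K`
odd and `L(E^{d_K},1) ≠ 0`, ANY globally minimal `Wd ≅ E^{d_K}`, and the EXACT index at slack `v₃(c)`
(`SchneiderFree.IndexLowerBoundLeAt ∧ SchneiderFree.Upper.IndexUpperBoundLeAt`): the rank-zero wild leaf
gives `BSDp Wd 3` — the twist is again a NON-CM O6 row (`classO6_twist_of_heegner`: `j(Wd) = j(W)`, so
`Wd` has CM iff `W` does, `hasCM_iff_of_j_eq`; `ρ̄_{E,3}` onto ⟹ no CM,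
`not_hasSurjectiveModNGaloisRep_of_hasCM`) of analytic rank `0` — and the generic descent
`SchneiderFree.Exact.bsdp_of_exactIndexManin_of_partner_bsdp` concludes (`3 ∤ #𝓞_K^×` and `3 ∤ d_K` are
automatic: `3 ∣ N` splits in `K`, `X11b.Three.not_dvd_discr_and_not_dvd_torsionOrder_of_heegner`).
So what the UTD kernel has left to produce is exactly: the data, and the EXACT index from its cruxes
(IMC by transport, unit Waldspurger value, control at `𝔭′`). CONDITIONAL on the named facts (hypotheses)
and on the leaf `WAllExclAddWildRankZero` (hypothesis); closes nothing by itself; BSD is not proved by any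
of this.

References: [GrossZagier1986] Thm. I.(6.3), (7.3); [JetchevSkinnerWan2017] §7.4.1; [Miller2011LMS]
Def. 1.1; [Zywina2015] Prop. 1.14/1.16.
-/

noncomputable section

open scoped Classical

open WeierstrassCurve NumberField IsDedekindDomain Field Literature.NumberTheory.EllipticCurves
  Literature.NumberTheory.EllipticCurves.ModularForms
  Literature.NumberTheory.EllipticCurves.Rank1Residual
  Literature.NumberTheory.EllipticCurves.Rank1Residual.Typed
  Summit.BirchSwinnertonDyer.Rank1Residual
  Summit.BirchSwinnertonDyer.Rank1Residual.Additive
  Summit.BirchSwinnertonDyer.Rank1Residual.X11b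

set_option linter.dupNamespace false
set_option autoImplicit false

namespace Summit.BirchSwinnertonDyer.BirchSwinnertonDyer.Theorems.SchneiderFree.Exact

/-- **Exact index at slack `v₃(c)` + the rank-zero wild leaf ⟹ `BSD₃(E)` on the attacked wild cell.**
For `W` globally minimal on `ClassO6 W 3` with `ρ̄_{E,3}` onto and `r_an = 1`, a Heegner datum with odd
`d_K` and `L(E^{d_K},1) ≠ 0`, any globally minimal `Wd ≅ E^{d_K}`, STEP L and co-STEP L at slack `v₃(c)`,
and the leaf `WAllExclAddWildRankZero` (as a hypothesis): `BSDp W 3`. The twist is a non-CM O6 row of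
analytic rank `0` (`classO6_twist_of_heegner`, `hasCM_iff_of_j_eq`, `not_hasSurjectiveModNGaloisRep_of_hasCM`),
so the leaf pays `BSDp Wd 3`, and `bsdp_of_exactIndexManin_of_partner_bsdp` descends. Facts by name as
hypotheses. [cite: GrossZagier1986, Thm. I.(6.3) and (7.3)] [cite: JetchevSkinnerWan2017, §7.4.1]
[cite: Zywina2015, Prop. 1.14 and Prop. 1.16] -/
theorem bsdp_three_of_exactIndexManin_of_wAllExclAddWildRankZero
    (hGZ : ∀ (N : ℕ) [NeZero N] (W : WeierstrassCurve ℚ) (K : Type) [Field K] [NumberField K],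
      gross_zagier N W K)
    (hKo : ∀ (N : ℕ) [NeZero N] (W : WeierstrassCurve ℚ) (K : Type) [Field K] [NumberField K],
      kolyvagin N W K)
    (hGZK : rank_eq_analyticRank_of_analyticRank_le_one) (hmod : hasEntireLFunction_rat)
    (hGZ73 : GrossZagier1986_thm_I_7_3)
    (hRZ : Summit.BirchSwinnertonDyer.WAllExclAddWildRankZero)
    (W : WeierstrassCurve ℚ) [W.IsElliptic] [W.IsGloballyMinimal]
    (hO6 : ClassO6 W 3) (hsurj : W.HasSurjectiveModNGaloisRep 3) (hr : W.analyticRank = 1)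
    (N : ℕ) [NeZero N] (K : Type) [Field K] [NumberField K]
    (Dt : ModularParametrizationData W N) (H : HeegnerDatum N (NumberField.discr K)) (ι : K →+* ℂ)
    (P : (W.baseChange K).toAffine.Point) (Wd : WeierstrassCurve ℚ) [Wd.IsElliptic] [Wd.IsGloballyMinimal]
    (hN : W.conductorNorm ℤ = N) (hK : IsImaginaryQuadratic K) (hodd : Odd (NumberField.discr K))
    (hHH : SatisfiesHeegnerHypothesis N K)
    (hLd : (W.quadraticTwist (NumberField.discr K : ℚ)).entireLFunction 1 ≠ 0)
    (hP : WeierstrassCurve.Affine.Point.map ι.toRatAlgHom P = heegnerPointComplex Dt H)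
    (hC : ∃ C : VariableChange ℚ, C • W.quadraticTwist (NumberField.discr K : ℚ) = Wd)
    (hlo : IndexLowerBoundLeAt W 3 K P (padicValNat 3 Dt.c.natAbs))
    (hup : Upper.IndexUpperBoundLeAt W 3 K P (padicValNat 3 Dt.c.natAbs)) :
    BSDp W 3 := by
  obtain ⟨Cd, hCd⟩ := hC
  have h3N : 3 ∣ W.conductorNorm ℤ :=
    (W.dvd_conductorNorm_iff_not_hasGoodReductionAtPrime 3).mpr (not_good_of_addv W 3 hO6.2.1)
  have hpN : 3 ∣ N := hN ▸ h3N
  have hHN' : SatisfiesHeegnerHypothesis (W.conductorNorm ℤ) K := by rw [hN]; exact hHH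
  have hw : ¬ 3 ∣ Units.torsionOrder K :=
    (X11b.Three.not_dvd_discr_and_not_dvd_torsionOrder_of_heegner hK hHH (by decide) hpN).2
  -- the twist: a non-CM O6 row of analytic rank `0`
  obtain ⟨hO6d, hjd⟩ := classO6_twist_of_heegner W hO6 K hK hHN' hodd Wd Cd hCd
  have hCM : ¬ W.HasCM := fun hCM ↦
    W.not_hasSurjectiveModNGaloisRep_of_hasCM hCM Nat.prime_three (by decide) hsurj
  have hCMd : ¬ Wd.HasCM := fun h ↦ hCM ((hasCM_iff_of_j_eq hjd).mp h)
  have hD0 : (NumberField.discr K : ℚ) ≠ 0 := by exact_mod_cast NumberField.discr_ne_zero K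
  haveI : (W.quadraticTwist (NumberField.discr K : ℚ)).IsElliptic := W.isElliptic_quadraticTwist hD0
  have hLd1 : Wd.entireLFunction 1 ≠ 0 := by rw [← hCd, entireLFunction_smul]; exact hLd
  have hrd : Wd.analyticRank = 0 := analyticRank_eq_zero_of_entireLFunction_one_ne_zero Wd hLd1
  have hWd : BSDp Wd 3 := hRZ Wd hCMd hO6d hrd
  exact bsdp_of_exactIndexManin_of_partner_bsdp hGZ hKo hGZK hmod hGZ73 W 3 N K Dt H ι P Wd hr hN hpN hK
    hodd hw hHH hLd hP ⟨Cd, hCd⟩ (by decide) hlo hup hWd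

end Summit.BirchSwinnertonDyer.BirchSwinnertonDyer.Theorems.SchneiderFree.Exact

end
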